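import Literature.MathematicalPhysics.QuantumFieldTheory.Balaban1983to89.B11Eq129Minimizer

/-!
# Bałaban, CMP **102** (1985) 277–309 [B11] — (131)–(133) and (137) p. 298: the `Δ_a`-orthogonal projection `P₀`
onto `{QA′ = 0}`, the projected equation for `A₀ = A′₁ − H₀B`, and the identity (137) for `Δ_πH`

Honest framing: statement-level skeleton of published theorems with citation tags; proofs where landed; nothing
here is a claim about the Yang–Mills mass gap.

## What is printed (p. 298, render `…-p022-x2.png`, read as an image)

«By the definition of `H₀B` and the condition `QδA′ = 0` we have `⟨δA′, Δ_aH₀B⟩ = 0`.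
Next, let us construct a projection `P₀` onto the subspace `{A′ : QA′ = 0}` in the space of fields `A′` on `Ω₀`, with
the scalar product `⟨·, Δ_a·⟩`. It is again very easy to find that the projection is given by
`P₀ = I − GQ*(QGQ*)⁻¹Q. (131)`
Taking `δA′ = P₀A′`, where `A′` is arbitrary, and substituting into Eq. (128), we get the following equation,
`⟨A′, P₀*J⟩ + ⟨A′, Δ_aP₀A₀⟩ − ⟨A′, P₀*Δ^{(2)}A′₁⟩ + ⟨A′, P₀*((δ/δA′)V)(A′₁)⟩ = 0. (132)`
By the definition of `H₀B` we have `QA₀ = 0`, hence `P₀A₀ = A₀`, `Δ_aA₀ = (Δ + DRD*)A₀`. The above equation is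
satisfied for arbitrary `A′`, hence we get
`(Δ + DRD*)A₀ = −P₀*J + P₀*Δ^{(2)}A′₁ − P₀*((δ/δA′)V)(A′₁). (133)`»
… «Indeed, (3.126) [5] yields
`Δ_πH = (Δ_π + DRD* + Q*aQ)H − Q*a(L^{j(·)}η)⁻¹ = Q*(QGQ*)⁻¹(L^{j(·)}η)⁻¹ − Q*a(L^{j(·)}η)⁻¹, (137)`
hence `|Δ_πHB|_{(−3)} ≤ O(1)|B|`» (p. 299, first line).

## What is here (kernel-checked, sorry-free; abstract real inner-product spaces, vocabulary of `B11Eq129Minimizer`)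

`E` (fields `A′`), `F` (block data); `Δ` (print `Δ_a`) with right inverse `G` (`Δ(Gx) = x`), `Q : E → F` with adjoint
`Qadj` (`⟪Qx, y⟫ = ⟪x, Qadj y⟫`), `Kinv = (QGQ*)⁻¹` (`Q(G(Qadj(Kinv y))) = y`); `hOp G Qadj Kinv b = GQ*(QGQ*)⁻¹b`
(= `H₀` of (129), = `H` of (3.126) [5] on `b = (L^{j(·)}η)⁻¹B`).
* §1 **(131)** `proj0 = I − GQ*(QGQ*)⁻¹Q`: `Q ∘ P₀ = 0`, `P₀ = id` on `ker Q`, `P₀² = P₀`, and the `Δ_a`-orthogonality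
  `⟪P₀x, Δ(y − P₀y)⟫ = 0`, `⟪P₀x, Δy⟫ = ⟪x, Δ(P₀y)⟫` («projection … with the scalar product ⟨·, Δ_a·⟩»; `Δ` symmetric) —
  all PROVED.
* §2 **(132)–(133)** in weak form (`⟨A′, P₀*X⟩` written as `⟨P₀A′, X⟩`, the functional derivative as a linear
  functional `DV`): from (128) on `ker Q` and `A′₁ = A₀ + H₀b`, `QA₀ = 0`:
  `⟨P₀A′, J⟩ + ⟨A′, Δ_a(P₀A₀)⟩ − ⟨P₀A′, Δ^{(2)}A′₁⟩ + DV(P₀A′) = 0` for all `A′` (`eq132`) and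
  `⟨A′, Δ_aA₀⟩ = −⟨P₀A′, J⟩ + ⟨P₀A′, Δ^{(2)}A′₁⟩ − DV(P₀A′)` for all `A′` (`eq133_weak`), with
  `Δ_aA₀ = (Δ + DRD*)A₀` for `QA₀ = 0` (`laplaceA_apply_of_ker`).
* §3 **(137)** `Δ_π(Hb) = Q*(QGQ*)⁻¹b − Q*(a·b)` for `Δ_π = Δ_a − DRD* − Q*aQ` and `RD*(Hb) = 0` (`eq137`), and the
  operator-norm consequence `‖Δ_π(Hb)‖ ≤ c_Q(c_K + |a|)‖b‖` (`norm_eq137_le`; print: `|Δ_πHB|_{(−3)} ≤ O(1)|B|`).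

## HONEST SCOPE — what is NOT claimed

Vector (strong) forms of (132)–(133) with a genuine adjoint `P₀*` (they follow from the weak forms in a Hilbert
space; not spelled out), the lattice formulas (134)–(135), the bounds (136), (138)–(140) and the weighted norms
`|·|_{(−3)}` of the print are NOT typed; the constants of `norm_eq137_le` are abstract operator bounds for `Q*` and
`(QGQ*)⁻¹` (in print: from Thm 3.3 / (3.133) of [5]).  Nothing here is progress on the summit `Summit.QuantumFields`.
-/

namespace Literature.MathematicalPhysics.QuantumFieldTheory.Balaban1983to89.B11Eq131Projection

open scoped InnerProductSpace
open B11Eq129Minimizer (hOp constraint_hOp inner_delta_hOp_eq_zero)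

variable {E F : Type*} [NormedAddCommGroup E] [InnerProductSpace ℝ E] [NormedAddCommGroup F]
  [InnerProductSpace ℝ F]

/-! ## §1 (131): the projection `P₀ = I − GQ*(QGQ*)⁻¹Q` -/

/-- **(131)** `P₀ = I − GQ*(QGQ*)⁻¹Q`. [cite: Balaban1985Variational, (131) p.298] -/
def proj0 (G : E →ₗ[ℝ] E) (Q : E →ₗ[ℝ] F) (Qadj : F →ₗ[ℝ] E) (Kinv : F →ₗ[ℝ] F) : E →ₗ[ℝ] E :=
  LinearMap.id - G ∘ₗ Qadj ∘ₗ Kinv ∘ₗ Q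

variable {Δ G : E →ₗ[ℝ] E} {Q : E →ₗ[ℝ] F} {Qadj : F →ₗ[ℝ] E} {Kinv : F →ₗ[ℝ] F}

/-- `P₀A′ = A′ − H₀(QA′)` (API for (131)). [cite: Balaban1985Variational, (131) p.298] -/
theorem proj0_apply (A : E) : proj0 G Q Qadj Kinv A = A - hOp G Qadj Kinv (Q A) := rfl

/-- `P₀` maps into `{QA′ = 0}`: `Q(P₀A′) = QA′ − QGQ*(QGQ*)⁻¹QA′ = 0`. [cite: Balaban1985Variational, (131) p.298] -/
theorem apply_Q_proj0 (hK : ∀ y : F, Q (G (Qadj (Kinv y))) = y) (A : E) : Q (proj0 G Q Qadj Kinv A) = 0 := by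
  rw [proj0_apply, map_sub, constraint_hOp hK, sub_self]

/-- `P₀` is the identity on `{QA′ = 0}` («`QA₀ = 0`, hence `P₀A₀ = A₀`»). [cite: Balaban1985Variational, (131)-(133) p.298] -/
theorem proj0_of_ker {A : E} (hA : Q A = 0) : proj0 G Q Qadj Kinv A = A := by
  rw [proj0_apply, hA, hOp, map_zero, map_zero, map_zero, sub_zero]

/-- `P₀² = P₀` («a projection … onto the subspace {A′ : QA′ = 0}»). [cite: Balaban1985Variational, (131) p.298] -/
theorem proj0_idem (hK : ∀ y : F, Q (G (Qadj (Kinv y))) = y) (A : E) :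
    proj0 G Q Qadj Kinv (proj0 G Q Qadj Kinv A) = proj0 G Q Qadj Kinv A :=
  proj0_of_ker (apply_Q_proj0 hK A)

/-- `Δ_a`-orthogonality of the splitting `A′ = P₀A′ + H₀(QA′)`: `⟨P₀x, Δ_a(y − P₀y)⟩ = 0` («with the scalar product
⟨·, Δ_a·⟩»; the p. 298 remark `⟨δA′, Δ_aH₀B⟩ = 0`). [cite: Balaban1985Variational, (131) p.298] -/
theorem inner_proj0_delta_compl (hΔG : ∀ x : E, Δ (G x) = x)
    (hadj : ∀ (x : E) (y : F), ⟪Q x, y⟫_ℝ = ⟪x, Qadj y⟫_ℝ) (hK : ∀ y : F, Q (G (Qadj (Kinv y))) = y) (x y : E) :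
    ⟪proj0 G Q Qadj Kinv x, Δ (y - proj0 G Q Qadj Kinv y)⟫_ℝ = 0 := by
  rw [proj0_apply (A := y), sub_sub_cancel]
  exact inner_delta_hOp_eq_zero hΔG hadj (Q y) (apply_Q_proj0 hK x)

/-- `P₀*Δ_a = Δ_aP₀`: `⟨P₀x, Δ_ay⟩ = ⟨x, Δ_a(P₀y)⟩` for symmetric `Δ_a` (used in passing from (128) to (132)).
[cite: Balaban1985Variational, (131)-(132) p.298] -/
theorem inner_proj0_delta_comm (hsymm : ∀ x y : E, ⟪Δ x, y⟫_ℝ = ⟪x, Δ y⟫_ℝ) (hΔG : ∀ x : E, Δ (G x) = x)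
    (hadj : ∀ (x : E) (y : F), ⟪Q x, y⟫_ℝ = ⟪x, Qadj y⟫_ℝ) (hK : ∀ y : F, Q (G (Qadj (Kinv y))) = y) (x y : E) :
    ⟪proj0 G Q Qadj Kinv x, Δ y⟫_ℝ = ⟪x, Δ (proj0 G Q Qadj Kinv y)⟫_ℝ := by
  have h1 : ⟪proj0 G Q Qadj Kinv x, Δ y⟫_ℝ =
      ⟪proj0 G Q Qadj Kinv x, Δ (proj0 G Q Qadj Kinv y)⟫_ℝ := by
    have := inner_proj0_delta_compl (Δ := Δ) hΔG hadj hK x y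
    rw [map_sub, inner_sub_right, sub_eq_zero] at this
    exact this
  have h2 : ⟪x, Δ (proj0 G Q Qadj Kinv y)⟫_ℝ =
      ⟪proj0 G Q Qadj Kinv x, Δ (proj0 G Q Qadj Kinv y)⟫_ℝ := by
    have h3 : ⟪proj0 G Q Qadj Kinv y, Δ (hOp G Qadj Kinv (Q x))⟫_ℝ = 0 :=
      inner_delta_hOp_eq_zero hΔG hadj (Q x) (apply_Q_proj0 hK y)
    have h4 : ⟪hOp G Qadj Kinv (Q x), Δ (proj0 G Q Qadj Kinv y)⟫_ℝ = 0 := by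
      rw [← hsymm, real_inner_comm]
      exact h3
    have hx : x = proj0 G Q Qadj Kinv x + hOp G Qadj Kinv (Q x) := by
      rw [proj0_apply, sub_add_cancel]
    conv_lhs => rw [hx]
    rw [inner_add_left, h4, add_zero]
  rw [h1, h2]

/-! ## §2 (132)–(133): the projected Euler–Lagrange equation for `A₀ = A′₁ − H₀b` -/

/-- **(132)** (weak form): substituting `δA′ = P₀A′` into (128) — `⟨δA′, J⟩ + ⟨δA′, Δ_aA′₁⟩ − ⟨δA′, Δ^{(2)}A′₁⟩ +
⟨δA′, V′⟩ = 0` on `{QδA′ = 0}` — with `A′₁ = A₀ + H₀b`, `QA₀ = 0`, gives for ALL `A′`: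
`⟨P₀A′, J⟩ + ⟨A′, Δ_a(P₀A₀)⟩ − ⟨P₀A′, Δ^{(2)}A′₁⟩ + DV(P₀A′) = 0`. [cite: Balaban1985Variational, (132) p.298] -/
theorem eq132 {Δ2 : E →ₗ[ℝ] E} (hsymm : ∀ x y : E, ⟪Δ x, y⟫_ℝ = ⟪x, Δ y⟫_ℝ) (hΔG : ∀ x : E, Δ (G x) = x)
    (hadj : ∀ (x : E) (y : F), ⟪Q x, y⟫_ℝ = ⟪x, Qadj y⟫_ℝ) (hK : ∀ y : F, Q (G (Qadj (Kinv y))) = y)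
    {J A₀ : E} {b : F} (DV : E →ₗ[ℝ] ℝ)
    (h128 : ∀ δ : E, Q δ = 0 →
      ⟪δ, J⟫_ℝ + ⟪δ, Δ (A₀ + hOp G Qadj Kinv b)⟫_ℝ - ⟪δ, Δ2 (A₀ + hOp G Qadj Kinv b)⟫_ℝ + DV δ = 0)
    (A : E) :
    ⟪proj0 G Q Qadj Kinv A, J⟫_ℝ + ⟪A, Δ (proj0 G Q Qadj Kinv A₀)⟫_ℝ
      - ⟪proj0 G Q Qadj Kinv A, Δ2 (A₀ + hOp G Qadj Kinv b)⟫_ℝ + DV (proj0 G Q Qadj Kinv A) = 0 := by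
  have h := h128 (proj0 G Q Qadj Kinv A) (apply_Q_proj0 hK A)
  rw [map_add, inner_add_right, inner_delta_hOp_eq_zero hΔG hadj b (apply_Q_proj0 hK A), add_zero,
    inner_proj0_delta_comm hsymm hΔG hadj hK] at h
  exact h

/-- **(133)** (weak form): since `QA₀ = 0` gives `P₀A₀ = A₀`, (132) says `Δ_aA₀ = −P₀*J + P₀*Δ^{(2)}A′₁ − P₀*V′`
tested against every `A′`: `⟨A′, Δ_aA₀⟩ = −⟨P₀A′, J⟩ + ⟨P₀A′, Δ^{(2)}A′₁⟩ − DV(P₀A′)`.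
[cite: Balaban1985Variational, (133) p.298] -/
theorem eq133_weak {Δ2 : E →ₗ[ℝ] E} (hsymm : ∀ x y : E, ⟪Δ x, y⟫_ℝ = ⟪x, Δ y⟫_ℝ) (hΔG : ∀ x : E, Δ (G x) = x)
    (hadj : ∀ (x : E) (y : F), ⟪Q x, y⟫_ℝ = ⟪x, Qadj y⟫_ℝ) (hK : ∀ y : F, Q (G (Qadj (Kinv y))) = y)
    {J A₀ : E} {b : F} (hA₀ : Q A₀ = 0) (DV : E →ₗ[ℝ] ℝ)
    (h128 : ∀ δ : E, Q δ = 0 →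
      ⟪δ, J⟫_ℝ + ⟪δ, Δ (A₀ + hOp G Qadj Kinv b)⟫_ℝ - ⟪δ, Δ2 (A₀ + hOp G Qadj Kinv b)⟫_ℝ + DV δ = 0)
    (A : E) :
    ⟪A, Δ A₀⟫_ℝ = -⟪proj0 G Q Qadj Kinv A, J⟫_ℝ
      + ⟪proj0 G Q Qadj Kinv A, Δ2 (A₀ + hOp G Qadj Kinv b)⟫_ℝ - DV (proj0 G Q Qadj Kinv A) := by
  have h := eq132 hsymm hΔG hadj hK DV h128 A
  rw [proj0_of_ker hA₀] at h
  linarith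

section LaplaceA

variable {S : Type*} [AddCommGroup S] [Module ℝ S]

/-- «`QA₀ = 0`, hence … `Δ_aA₀ = (Δ + DRD*)A₀`» for `Δ_a = Δ + DRD* + Q*aQ`.
[cite: Balaban1985Variational, (133) p.298] -/
theorem laplaceA_apply_of_ker (Δ' : E →ₗ[ℝ] E) (D : S →ₗ[ℝ] E) (R : S →ₗ[ℝ] S) (Dstar : E →ₗ[ℝ] S)
    (a : ℝ) {A₀ : E} (hA₀ : Q A₀ = 0) :
    (Δ' + D ∘ₗ R ∘ₗ Dstar + Qadj ∘ₗ (a • Q)) A₀ = (Δ' + D ∘ₗ R ∘ₗ Dstar) A₀ := by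
  simp only [LinearMap.add_apply, LinearMap.comp_apply, LinearMap.smul_apply, hA₀, smul_zero, map_zero, add_zero]

/-! ## §3 (137): `Δ_πH = Q*(QGQ*)⁻¹(L^{j(·)}η)⁻¹ − Q*a(L^{j(·)}η)⁻¹` -/

/-- **(137)**: with `Δ_a = Δ_π + DRD* + Q*aQ` (so `Δ_π = Δ_a − DRD* − Q*aQ`), `G = Δ_a⁻¹`, `H = GQ*(QGQ*)⁻¹` and
`RD*H = 0` ((45)): `Δ_π(Hb) = Δ_a(Hb) − Q*a·Q(Hb) = Q*(QGQ*)⁻¹b − Q*(a·b)` (`b = (L^{j(·)}η)⁻¹B`).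
[cite: Balaban1985Variational, (137) p.298] -/
theorem eq137 (hΔG : ∀ x : E, Δ (G x) = x) (hK : ∀ y : F, Q (G (Qadj (Kinv y))) = y)
    (D : S →ₗ[ℝ] E) (R : S →ₗ[ℝ] S) (Dstar : E →ₗ[ℝ] S) (a : ℝ) (b : F)
    (hRD : R (Dstar (hOp G Qadj Kinv b)) = 0) :
    (Δ - D ∘ₗ R ∘ₗ Dstar - Qadj ∘ₗ (a • Q)) (hOp G Qadj Kinv b) = Qadj (Kinv b) - Qadj (a • b) := by
  simp only [LinearMap.sub_apply, LinearMap.comp_apply, LinearMap.smul_apply, hRD, map_zero, sub_zero,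
    constraint_hOp hK]
  rw [hOp, hΔG]

end LaplaceA

/-- «hence `|Δ_πHB|_{(−3)} ≤ O(1)|B|`» — the operator-norm content of (137): with bounds `‖Q*y‖ ≤ c_Q‖y‖`,
`‖(QGQ*)⁻¹y‖ ≤ c_K‖y‖`, `‖Δ_π(Hb)‖ ≤ c_Q(c_K + |a|)‖b‖`. [cite: Balaban1985Variational, (137) p.298, p.299 l.1] -/
theorem norm_eq137_le {X : E} {b : F} {a cQ cK : ℝ} (hX : X = Qadj (Kinv b) - Qadj (a • b))
    (hQadj : ∀ y : F, ‖Qadj y‖ ≤ cQ * ‖y‖) (hKinv : ∀ y : F, ‖Kinv y‖ ≤ cK * ‖y‖) (hcQ : 0 ≤ cQ) :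
    ‖X‖ ≤ cQ * (cK + |a|) * ‖b‖ := by
  rw [hX, ← map_sub]
  calc ‖Qadj (Kinv b - a • b)‖ ≤ cQ * ‖Kinv b - a • b‖ := hQadj _
    _ ≤ cQ * (‖Kinv b‖ + ‖a • b‖) := by gcongr; exact norm_sub_le _ _
    _ ≤ cQ * (cK * ‖b‖ + |a| * ‖b‖) := by
        gcongr
        · exact hKinv b
        · rw [norm_smul, Real.norm_eq_abs]
    _ = cQ * (cK + |a|) * ‖b‖ := by ring

end Literature.MathematicalPhysics.QuantumFieldTheory.Balaban1983to89.B11Eq131Projection
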